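import Summits.CriticalPhenomena.PercolationContinuityZ3.Theorems.SahiMasterFamilyFCombFaceShiftDetTwistedDefs

/-!
# THEOREM R***-τ: unimodularity of the TWISTED face-domination kernel on up-sets of `{0<1<2}^J` (support file)

Support file (prover seat `prim-bnk-2`, gen 32; `--supports stmt-CriticalPhenomena-4575`).  Proof document
`run/shared/lean/prim/prim-l12/prim-bnk-2/PROOF-THEOREM-I1-STAR.md` §4(b) — the determinant behind the routing lemma J**-τ of SCHEME Σ*
(Conjecture V for one-shared-coordinate pairs and an ARBITRARY twist τ); census `code/g32/rstar_tw.py` (all 122 732 instances |J| ≤ 4).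

**THEOREM R***-τ (`isUnit_det_faceInclT`).**  For every set `T` of twisted coordinates and every family `ℱ` of faces closed under the
moves `0 → 1` and `1 → 2` (an up-set of `{0<1<2}^l`), `det (faceInclT T l ℱ ℱ) = ±1` (kernel of `…FaceShiftDetTwistedDefs`).
Proof: the induction of THEOREM R*** (`isUnit_det_faceIncl`, all coordinates untwisted) — split the first coordinate `c`, sections
`A₀ ⊆ A₁ ⊆ A₂`; the entries factor as (incidence at `c`) × (kernel over `l` on the section representatives).  For `c ∉ T` the block matrix
`[[0,K₀₁,0],[0,0,K₁₂],[K₂₀,K₂₁,K₂₂]]` is eliminated as in R***; for `c ∈ T` it is `[[0,0,K₀₂],[K₁₀,0,K₁₂],[0,K₂₁,K₂₂]]`, and two Schur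
complements (on `K₂₂`, then on `K₁₁`) with the selection identity `K_ab ⅟K_bb K_bc = K_ac` reduce `det` to `± det K₂₂ · det K₁₁ · det K₀₀`
in both cases.  No definitions; no `sorry`; standard axioms.
-/

namespace Summit.CriticalPhenomena.PercolationContinuityZ3.Theorems

namespace SahiFComb.Shift

open Finset Matrix
open scoped Classical

variable {α : Type*} [DecidableEq α]

variable (T : Finset α)

/-- **THEOREM R***-τ (prim-bnk-2 g32, PROOF-THEOREM-I1-STAR §4(b)).**  For every set `T` of twisted coordinates and every family `ℱ` of
faces `(w,t)` (disjoint finsets supported on the duplicate-free list `l`) closed under `(w,t) ↦ (insert a w, t)` (`a ∈ l` fresh) and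
`(w,t) ↦ (w.erase a, insert a t)` (`a ∈ w`), the twisted face-domination kernel `faceInclT T l ℱ ℱ` has a unit determinant. [this work] -/
theorem isUnit_det_faceInclT :
    ∀ (l : List α), l.Nodup → ∀ (ℱ : Finset (Finset α × Finset α)),
      (∀ p ∈ ℱ, Disjoint p.1 p.2) →
      (∀ p ∈ ℱ, ∀ a, a ∈ p.1 ∨ a ∈ p.2 → a ∈ l) →
      (∀ p ∈ ℱ, ∀ a ∈ l, a ∉ p.1 → a ∉ p.2 → (insert a p.1, p.2) ∈ ℱ) →
      (∀ p ∈ ℱ, ∀ a ∈ p.1, (p.1.erase a, insert a p.2) ∈ ℱ) →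
      IsUnit (faceInclT T l ℱ ℱ).det
  | [], _, ℱ, hd, hs, _, _ => by
    -- every face is `(∅, ∅)`: the matrix is `0 × 0` or the `1 × 1` matrix `(1)`
    have hall : ∀ p ∈ ℱ, p = (∅, ∅) := by
      intro p hp
      have h1 : p.1 = ∅ := eq_empty_of_forall_notMem fun a ha => by simpa using hs p hp a (Or.inl ha)
      have h2 : p.2 = ∅ := eq_empty_of_forall_notMem fun a ha => by simpa using hs p hp a (Or.inr ha)
      exact Prod.ext h1 h2
    have hM : faceInclT T [] ℱ ℱ = 1 := by
      ext f g
      have hfg : f = g := Subtype.ext ((hall f.1 f.2).trans (hall g.1 g.2).symm)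
      subst hfg
      rw [faceInclT_apply, Matrix.one_apply_eq, if_pos]
      exact fun a ha => absurd ha List.not_mem_nil
    rw [hM, Matrix.det_one]; exact isUnit_one
  | c :: l, hl, ℱ, hd, hs, h01, h12 => by
    obtain ⟨hcl, hl'⟩ : c ∉ l ∧ l.Nodup := List.nodup_cons.1 hl
    -- the three sections along `c`
    set A₀ : Finset (Finset α × Finset α) := ℱ.filter (fun p => c ∉ p.1 ∧ c ∉ p.2) with hA₀
    set A₁ : Finset (Finset α × Finset α) := (ℱ.filter (fun p => c ∈ p.1)).image (fun p => (p.1.erase c, p.2)) with hA₁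
    set A₂ : Finset (Finset α × Finset α) := (ℱ.filter (fun p => c ∈ p.2)).image (fun p => (p.1, p.2.erase c)) with hA₂
    letI dA₀ : DecidableEq ↥A₀ := Subtype.instDecidableEq
    letI dA₁ : DecidableEq ↥A₁ := Subtype.instDecidableEq
    letI dA₂ : DecidableEq ↥A₂ := Subtype.instDecidableEq
    have mem0 : ∀ q, q ∈ A₀ ↔ q ∈ ℱ ∧ c ∉ q.1 ∧ c ∉ q.2 := fun q => by rw [hA₀, mem_filter]
    have mem1 : ∀ q : Finset α × Finset α, q ∈ A₁ ↔ c ∉ q.1 ∧ c ∉ q.2 ∧ (insert c q.1, q.2) ∈ ℱ := by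
      intro q
      rw [hA₁, mem_image]
      constructor
      · rintro ⟨p, hp, rfl⟩
        rw [mem_filter] at hp
        refine ⟨notMem_erase c p.1, ?_, ?_⟩
        · exact fun h => (disjoint_left.1 (hd p hp.1)) hp.2 h
        · rw [insert_erase hp.2]; exact hp.1
      · rintro ⟨h1, -, h3⟩
        exact ⟨(insert c q.1, q.2), mem_filter.2 ⟨h3, mem_insert_self c q.1⟩, by rw [erase_insert h1]⟩
    have mem2 : ∀ q : Finset α × Finset α, q ∈ A₂ ↔ c ∉ q.1 ∧ c ∉ q.2 ∧ (q.1, insert c q.2) ∈ ℱ := by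
      intro q
      rw [hA₂, mem_image]
      constructor
      · rintro ⟨p, hp, rfl⟩
        rw [mem_filter] at hp
        refine ⟨?_, notMem_erase c p.2, ?_⟩
        · exact fun h => (disjoint_left.1 (hd p hp.1)) h hp.2
        · rw [insert_erase hp.2]; exact hp.1
      · rintro ⟨-, h2, h3⟩
        exact ⟨(q.1, insert c q.2), mem_filter.2 ⟨h3, mem_insert_self c q.2⟩, by rw [erase_insert h2]⟩
    -- nestedness of the sections
    have hA₀₁ : A₀ ⊆ A₁ := by
      intro q hq
      rw [mem0] at hq
      rw [mem1]
      exact ⟨hq.2.1, hq.2.2, h01 q hq.1 c List.mem_cons_self hq.2.1 hq.2.2⟩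
    have hA₁₂ : A₁ ⊆ A₂ := by
      intro q hq
      rw [mem1] at hq
      rw [mem2]
      refine ⟨hq.1, hq.2.1, ?_⟩
      have := h12 _ hq.2.2 c (mem_insert_self c q.1)
      rwa [erase_insert hq.1] at this
    -- the sections satisfy the hypotheses for `l`
    have secHyp : ∀ (A : Finset (Finset α × Finset α)),
        (∀ q : Finset α × Finset α, q ∈ A → c ∉ q.1 ∧ c ∉ q.2) →
        (∀ q : Finset α × Finset α, q ∈ A → ∃ w t, (w, t) ∈ ℱ ∧ q.1 ⊆ w ∧ q.2 ⊆ t ∧ w ⊆ insert c q.1 ∧ t ⊆ insert c q.2) →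
        (∀ q ∈ A, Disjoint q.1 q.2) ∧ (∀ q ∈ A, ∀ a, a ∈ q.1 ∨ a ∈ q.2 → a ∈ l) := by
      intro A hc hlift
      constructor
      · intro q hq
        obtain ⟨w, t, hwt, h1, h2, -, -⟩ := hlift q hq
        exact (hd _ hwt).mono h1 h2
      · intro q hq a ha
        obtain ⟨w, t, hwt, h1, h2, -, -⟩ := hlift q hq
        have hal : a ∈ c :: l := hs _ hwt a (ha.imp (fun h => h1 h) (fun h => h2 h))
        rcases List.mem_cons.1 hal with rfl | h
        · exact absurd ha (not_or.2 (hc q hq))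
        · exact h
    have hyp0 := secHyp A₀ (fun q hq => ((mem0 q).1 hq).2)
      (fun q hq => ⟨q.1, q.2, ((mem0 q).1 hq).1, Subset.refl _, Subset.refl _, subset_insert _ _, subset_insert _ _⟩)
    have hyp1 := secHyp A₁ (fun q hq => ⟨((mem1 q).1 hq).1, ((mem1 q).1 hq).2.1⟩)
      (fun q hq => ⟨insert c q.1, q.2, ((mem1 q).1 hq).2.2, subset_insert _ _, Subset.refl _, Subset.refl _, subset_insert _ _⟩)
    have hyp2 := secHyp A₂ (fun q hq => ⟨((mem2 q).1 hq).1, ((mem2 q).1 hq).2.1⟩)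
      (fun q hq => ⟨q.1, insert c q.2, ((mem2 q).1 hq).2.2, Subset.refl _, subset_insert _ _, subset_insert _ _, Subset.refl _⟩)
    have h01_0 : ∀ q ∈ A₀, ∀ a ∈ l, a ∉ q.1 → a ∉ q.2 → (insert a q.1, q.2) ∈ A₀ := by
      intro q hq a ha h1 h2
      have hq' := (mem0 q).1 hq
      have hac : a ≠ c := fun h => hcl (h ▸ ha)
      rw [mem0]
      exact ⟨h01 q hq'.1 a (List.mem_cons_of_mem _ ha) h1 h2, by
        rw [mem_insert, not_or]; exact ⟨hac.symm, hq'.2.1⟩, hq'.2.2⟩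
    have h12_0 : ∀ q ∈ A₀, ∀ a ∈ q.1, (q.1.erase a, insert a q.2) ∈ A₀ := by
      intro q hq a ha
      have hq' := (mem0 q).1 hq
      have hac : a ≠ c := fun h => hq'.2.1 (h ▸ ha)
      rw [mem0]
      exact ⟨h12 q hq'.1 a ha, fun h => hq'.2.1 (mem_of_mem_erase h), by
        rw [mem_insert, not_or]; exact ⟨hac.symm, hq'.2.2⟩⟩
    have h01_1 : ∀ q ∈ A₁, ∀ a ∈ l, a ∉ q.1 → a ∉ q.2 → (insert a q.1, q.2) ∈ A₁ := by
      intro q hq a ha h1 h2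
      have hq' := (mem1 q).1 hq
      have hac : a ≠ c := fun h => hcl (h ▸ ha)
      rw [mem1]
      refine ⟨by rw [mem_insert, not_or]; exact ⟨hac.symm, hq'.1⟩, hq'.2.1, ?_⟩
      have := h01 _ hq'.2.2 a (List.mem_cons_of_mem _ ha)
        (by rw [mem_insert, not_or]; exact ⟨hac, h1⟩) h2
      rwa [Finset.insert_comm] at this
    have h12_1 : ∀ q ∈ A₁, ∀ a ∈ q.1, (q.1.erase a, insert a q.2) ∈ A₁ := by
      intro q hq a ha
      have hq' := (mem1 q).1 hq
      have hac : a ≠ c := fun h => hq'.1 (h ▸ ha)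
      rw [mem1]
      refine ⟨fun h => hq'.1 (mem_of_mem_erase h), by rw [mem_insert, not_or]; exact ⟨hac.symm, hq'.2.1⟩, ?_⟩
      have := h12 _ hq'.2.2 a (mem_insert_of_mem ha)
      rwa [erase_insert_of_ne hac.symm] at this
    have h01_2 : ∀ q ∈ A₂, ∀ a ∈ l, a ∉ q.1 → a ∉ q.2 → (insert a q.1, q.2) ∈ A₂ := by
      intro q hq a ha h1 h2
      have hq' := (mem2 q).1 hq
      have hac : a ≠ c := fun h => hcl (h ▸ ha)
      rw [mem2]
      refine ⟨by rw [mem_insert, not_or]; exact ⟨hac.symm, hq'.1⟩, hq'.2.1, ?_⟩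
      exact h01 _ hq'.2.2 a (List.mem_cons_of_mem _ ha) h1 (by rw [mem_insert, not_or]; exact ⟨hac, h2⟩)
    have h12_2 : ∀ q ∈ A₂, ∀ a ∈ q.1, (q.1.erase a, insert a q.2) ∈ A₂ := by
      intro q hq a ha
      have hq' := (mem2 q).1 hq
      have hac : a ≠ c := fun h => hq'.1 (h ▸ ha)
      rw [mem2]
      refine ⟨fun h => hq'.1 (mem_of_mem_erase h), by rw [mem_insert, not_or]; exact ⟨hac.symm, hq'.2.1⟩, ?_⟩
      have := h12 _ hq'.2.2 a ha
      rwa [Finset.insert_comm] at this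
    -- induction hypotheses
    have ih0 : IsUnit (faceInclT T l A₀ A₀).det := isUnit_det_faceInclT l hl' A₀ hyp0.1 hyp0.2 h01_0 h12_0
    have ih1 : IsUnit (faceInclT T l A₁ A₁).det := isUnit_det_faceInclT l hl' A₁ hyp1.1 hyp1.2 h01_1 h12_1
    have ih2 : IsUnit (faceInclT T l A₂ A₂).det := isUnit_det_faceInclT l hl' A₂ hyp2.1 hyp2.2 h01_2 h12_2
    letI : Invertible (faceInclT T l A₂ A₂) := Matrix.invertibleOfIsUnitDet _ ih2
    letI : Invertible (faceInclT T l A₁ A₁) := Matrix.invertibleOfIsUnitDet _ ih1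
    -- the reindexing `ℱ ≃ (A₀ ⊕ A₁) ⊕ A₂`
    have hcases : ∀ p ∈ ℱ, (c ∉ p.1 ∧ c ∉ p.2) ∨ c ∈ p.1 ∨ c ∈ p.2 := by
      intro p _; by_cases h1 : c ∈ p.1; exact Or.inr (Or.inl h1); by_cases h2 : c ∈ p.2; exact Or.inr (Or.inr h2)
      exact Or.inl ⟨h1, h2⟩
    let toP : (↥A₀ ⊕ ↥A₁) ⊕ ↥A₂ → ↥ℱ := fun x => match x with
      | Sum.inl (Sum.inl q) => ⟨q.1, ((mem0 q.1).1 q.2).1⟩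
      | Sum.inl (Sum.inr q) => ⟨(insert c q.1.1, q.1.2), ((mem1 q.1).1 q.2).2.2⟩
      | Sum.inr q => ⟨(q.1.1, insert c q.1.2), ((mem2 q.1).1 q.2).2.2⟩
    have toP_inj : Function.Injective toP := by
      rintro ((q | q) | q) ((q' | q') | q') h <;> simp only [toP, Subtype.mk.injEq] at h
      · exact congrArg _ (congrArg _ (Subtype.ext h))
      · exfalso; have := ((mem0 q.1).1 q.2).2.1; rw [h] at this; exact this (mem_insert_self _ _)
      · exfalso; have := ((mem0 q.1).1 q.2).2.2; rw [h] at this; exact this (mem_insert_self _ _)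
      · exfalso; have := ((mem0 q'.1).1 q'.2).2.1; rw [← h] at this; exact this (mem_insert_self _ _)
      · have hh := Prod.mk.inj h
        have h1 : q.1.1 = q'.1.1 := by
          rw [← erase_insert ((mem1 q.1).1 q.2).1, ← erase_insert ((mem1 q'.1).1 q'.2).1, hh.1]
        exact congrArg _ (congrArg _ (Subtype.ext (Prod.ext h1 hh.2)))
      · exfalso; have := ((mem2 q'.1).1 q'.2).1; rw [← (Prod.mk.inj h).1] at this; exact this (mem_insert_self _ _)
      · exfalso; have := ((mem0 q'.1).1 q'.2).2.2; rw [← h] at this; exact this (mem_insert_self _ _)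
      · exfalso; have := ((mem2 q.1).1 q.2).1; rw [(Prod.mk.inj h).1] at this; exact this (mem_insert_self _ _)
      · have hh := Prod.mk.inj h
        have h2 : q.1.2 = q'.1.2 := by
          rw [← erase_insert ((mem2 q.1).1 q.2).2.1, ← erase_insert ((mem2 q'.1).1 q'.2).2.1, hh.2]
        exact congrArg _ (Subtype.ext (Prod.ext hh.1 h2))
    have toP_surj : Function.Surjective toP := by
      intro p
      rcases hcases p.1 p.2 with h | h | h
      · exact ⟨Sum.inl (Sum.inl ⟨p.1, (mem0 _).2 ⟨p.2, h⟩⟩), rfl⟩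
      · refine ⟨Sum.inl (Sum.inr ⟨(p.1.1.erase c, p.1.2), (mem1 _).2 ⟨notMem_erase _ _, ?_, ?_⟩⟩), ?_⟩
        · exact fun h' => (disjoint_left.1 (hd _ p.2)) h h'
        · rw [insert_erase h]; exact p.2
        · apply Subtype.ext; show (insert c (p.1.1.erase c), p.1.2) = p.1; rw [insert_erase h]
      · refine ⟨Sum.inr ⟨(p.1.1, p.1.2.erase c), (mem2 _).2 ⟨?_, notMem_erase _ _, ?_⟩⟩, ?_⟩
        · exact fun h' => (disjoint_left.1 (hd _ p.2)) h' h
        · rw [insert_erase h]; exact p.2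
        · apply Subtype.ext; show (p.1.1, insert c (p.1.2.erase c)) = p.1; rw [insert_erase h]
    let e : (↥A₀ ⊕ ↥A₁) ⊕ ↥A₂ ≃ ↥ℱ := Equiv.ofBijective toP ⟨toP_inj, toP_surj⟩
    have e_ll : ∀ q : ↥A₀, ((e (Sum.inl (Sum.inl q)) : ↥ℱ) : Finset α × Finset α) = q.1 := fun q => rfl
    have e_lr : ∀ q : ↥A₁, ((e (Sum.inl (Sum.inr q)) : ↥ℱ) : Finset α × Finset α) = (insert c q.1.1, q.1.2) :=
      fun q => rfl
    have e_r : ∀ q : ↥A₂, ((e (Sum.inr q) : ↥ℱ) : Finset α × Finset α) = (q.1.1, insert c q.1.2) := fun q => rfl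
    -- entries of the big kernel: the `c`-test times the kernel over `l` on the section representatives
    have hl_ne : ∀ x ∈ l, x ≠ c := fun x hx h => hcl (h ▸ hx)
    have entry : ∀ (f g : Finset α × Finset α) (f₀ g₀ : Finset α × Finset α),
        (∀ a, a ≠ c → ((a ∈ f.1 ↔ a ∈ f₀.1) ∧ (a ∈ f.2 ↔ a ∈ f₀.2))) →
        (∀ a, a ≠ c → ((a ∈ g.1 ↔ a ∈ g₀.1) ∧ (a ∈ g.2 ↔ a ∈ g₀.2))) →
        ((if ∀ a ∈ c :: l, (f, g) ∈ relPairs T a then (1 : ℤ) else 0) =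
          if (f, g) ∈ relPairs T c then (if ∀ a ∈ l, (f₀, g₀) ∈ relPairs T a then 1 else 0) else 0) := by
      intro f g f₀ g₀ hf hg
      have hiff : (∀ a ∈ c :: l, (f, g) ∈ relPairs T a) ↔ (f, g) ∈ relPairs T c ∧ ∀ a ∈ l, (f₀, g₀) ∈ relPairs T a := by
        rw [List.forall_mem_cons]
        refine and_congr Iff.rfl (forall₂_congr fun a ha => ?_)
        exact relPairs_congr (hf a (hl_ne a ha)).1 (hf a (hl_ne a ha)).2 (hg a (hl_ne a ha)).1 (hg a (hl_ne a ha)).2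
      rw [if_congr hiff rfl rfl]
      by_cases h1 : (f, g) ∈ relPairs T c
      · simp only [h1, true_and, if_true]
      · simp only [h1, false_and, if_false]
    have liftq : ∀ (q : Finset α × Finset α) (a : α), a ≠ c →
        ((a ∈ q.1 ↔ a ∈ q.1) ∧ (a ∈ q.2 ↔ a ∈ q.2)) := fun q a _ => ⟨Iff.rfl, Iff.rfl⟩
    have lift1 : ∀ (q : Finset α × Finset α) (a : α), a ≠ c →
        ((a ∈ (insert c q.1, q.2).1 ↔ a ∈ q.1) ∧ (a ∈ (insert c q.1, q.2).2 ↔ a ∈ q.2)) := fun q a ha =>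
      ⟨by rw [mem_insert]; exact ⟨fun h => h.resolve_left ha, Or.inr⟩, Iff.rfl⟩
    have lift2 : ∀ (q : Finset α × Finset α) (a : α), a ≠ c →
        ((a ∈ (q.1, insert c q.2).1 ↔ a ∈ q.1) ∧ (a ∈ (q.1, insert c q.2).2 ↔ a ∈ q.2)) := fun q a ha =>
      ⟨Iff.rfl, by rw [mem_insert]; exact ⟨fun h => h.resolve_left ha, Or.inr⟩⟩
    have c0 : ∀ q : ↥A₀, c ∉ (q : Finset α × Finset α).1 ∧ c ∉ (q : Finset α × Finset α).2 :=
      fun q => ⟨((mem0 _).1 q.2).2.1, ((mem0 _).1 q.2).2.2⟩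
    have c1 : ∀ q : ↥A₁, c ∉ (q : Finset α × Finset α).1 ∧ c ∉ (q : Finset α × Finset α).2 :=
      fun q => ⟨((mem1 _).1 q.2).1, ((mem1 _).1 q.2).2.1⟩
    have c2 : ∀ q : ↥A₂, c ∉ (q : Finset α × Finset α).1 ∧ c ∉ (q : Finset α × Finset α).2 :=
      fun q => ⟨((mem2 _).1 q.2).1, ((mem2 _).1 q.2).2.1⟩
    have hdetD : (Matrix.fromBlocks (1 : Matrix ↥A₀ ↥A₀ ℤ) 0 0 (-1 : Matrix ↥A₁ ↥A₁ ℤ)).det = (-1 : Matrix ↥A₁ ↥A₁ ℤ).det := by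
      rw [Matrix.det_fromBlocks_zero₂₁, Matrix.det_one, one_mul]
    have hn0 : IsUnit (-(faceInclT T l A₀ A₀)).det := by
      rw [Matrix.det_neg]; exact (isUnit_one.neg.pow _).mul ih0
    have hn1 : IsUnit (-1 : Matrix ↥A₁ ↥A₁ ℤ).det := by
      rw [Matrix.det_neg, Matrix.det_one, mul_one]; exact isUnit_one.neg.pow _
    by_cases hcT : c ∈ T
    · -- twisted first coordinate: kernel `m′`
      let P : Matrix (↥A₀ ⊕ ↥A₁) (↥A₀ ⊕ ↥A₁) ℤ := Matrix.fromBlocks 0 0 (faceInclT T l A₁ A₀) 0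
      let Q : Matrix (↥A₀ ⊕ ↥A₁) ↥A₂ ℤ :=
        Matrix.of fun i j => Sum.elim (fun i₀ => faceInclT T l A₀ A₂ i₀ j) (fun i₁ => faceInclT T l A₁ A₂ i₁ j) i
      let R : Matrix ↥A₂ (↥A₀ ⊕ ↥A₁) ℤ :=
        Matrix.of fun i j => Sum.elim (fun _ => (0 : ℤ)) (fun j₁ => faceInclT T l A₂ A₁ i j₁) j
      have hM : (faceInclT T (c :: l) ℱ ℱ).submatrix e e = Matrix.fromBlocks P Q R (faceInclT T l A₂ A₂) := by
        ext x y
        rcases x with ((q | q) | q) <;> rcases y with ((q' | q') | q')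
        all_goals
          simp only [submatrix_apply, Matrix.fromBlocks_apply₁₁, Matrix.fromBlocks_apply₁₂, Matrix.fromBlocks_apply₂₁,
            Matrix.fromBlocks_apply₂₂, P, Q, R, Matrix.of_apply, Sum.elim_inl, Sum.elim_inr, Matrix.zero_apply,
            faceInclT_apply, e_ll, e_lr, e_r]
        · rw [entry _ _ q.1 q'.1 (liftq q.1) (liftq q'.1), if_neg]
          rw [mem_relPairs, if_pos hcT]; rintro ⟨h, -, -⟩; exact (c0 q').2 (h (c0 q).1 (c0 q).2)
        · rw [entry _ _ q.1 q'.1 (liftq q.1) (lift1 q'.1), if_neg]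
          rw [mem_relPairs, if_pos hcT]; rintro ⟨h, -, -⟩; exact (c1 q').2 (h (c0 q).1 (c0 q).2)
        · rw [entry _ _ q.1 q'.1 (liftq q.1) (lift2 q'.1), if_pos]
          rw [mem_relPairs, if_pos hcT]
          exact ⟨fun _ _ => mem_insert_self _ _, fun h => absurd h (c0 q).1, fun h => absurd h (c0 q).2⟩
        · rw [entry _ _ q.1 q'.1 (lift1 q.1) (liftq q'.1), if_pos]
          rw [mem_relPairs, if_pos hcT]
          exact ⟨fun h => absurd (mem_insert_self _ _) h, fun _ => (c0 q').1, fun h => absurd h (c1 q).2⟩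
        · rw [entry _ _ q.1 q'.1 (lift1 q.1) (lift1 q'.1), if_neg]
          rw [mem_relPairs, if_pos hcT]; rintro ⟨-, h, -⟩; exact h (mem_insert_self _ _) (mem_insert_self _ _)
        · rw [entry _ _ q.1 q'.1 (lift1 q.1) (lift2 q'.1), if_pos]
          rw [mem_relPairs, if_pos hcT]
          exact ⟨fun h => absurd (mem_insert_self _ _) h, fun _ => (c2 q').1, fun h => absurd h (c1 q).2⟩
        · rw [entry _ _ q.1 q'.1 (lift2 q.1) (liftq q'.1), if_neg]
          rw [mem_relPairs, if_pos hcT]; rintro ⟨-, -, h⟩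
          rcases h (mem_insert_self _ _) with h' | h'
          · exact (c0 q').1 h'
          · exact (c0 q').2 h'
        · rw [entry _ _ q.1 q'.1 (lift2 q.1) (lift1 q'.1), if_pos]
          rw [mem_relPairs, if_pos hcT]
          exact ⟨fun _ h => absurd (mem_insert_self _ _) h, fun h => absurd h (c2 q).1,
            fun _ => Or.inl (mem_insert_self _ _)⟩
        · rw [entry _ _ q.1 q'.1 (lift2 q.1) (lift2 q'.1), if_pos]
          rw [mem_relPairs, if_pos hcT]
          exact ⟨fun _ h => absurd (mem_insert_self _ _) h, fun h => absurd h (c2 q).1,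
            fun _ => Or.inr (mem_insert_self _ _)⟩
      have hQSR : Q * ⅟(faceInclT T l A₂ A₂) * R =
          Matrix.fromBlocks 0 (faceInclT T l A₀ A₁) 0 (faceInclT T l A₁ A₁) := by
        have h0 : ∀ (B : Finset (Finset α × Finset α)),
            faceInclT T l A₀ A₂ * ⅟(faceInclT T l A₂ A₂) * faceInclT T l A₂ B = faceInclT T l A₀ B :=
          fun B => faceInclT_mul_invOf_mul (hA₀₁.trans hA₁₂)
        have h1 : ∀ (B : Finset (Finset α × Finset α)),
            faceInclT T l A₁ A₂ * ⅟(faceInclT T l A₂ A₂) * faceInclT T l A₂ B = faceInclT T l A₁ B :=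
          fun B => faceInclT_mul_invOf_mul hA₁₂
        ext x y
        rcases x with (q | q) <;> rcases y with (q' | q')
        · simp [Q, R, Matrix.mul_apply]
        · have := congrFun (congrFun (h0 A₁) q) q'
          simp only [Matrix.mul_apply, Q, R, Matrix.of_apply, Sum.elim_inl, Sum.elim_inr,
            Matrix.fromBlocks_apply₁₂] at this ⊢
          exact this
        · simp [Q, R, Matrix.mul_apply]
        · have := congrFun (congrFun (h1 A₁) q) q'
          simp only [Matrix.mul_apply, Q, R, Matrix.of_apply, Sum.elim_inr, Matrix.fromBlocks_apply₂₂] at this ⊢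
          exact this
      have hSchur1 : P - Q * ⅟(faceInclT T l A₂ A₂) * R =
          Matrix.fromBlocks (1 : Matrix ↥A₀ ↥A₀ ℤ) 0 0 (-1 : Matrix ↥A₁ ↥A₁ ℤ) *
            Matrix.fromBlocks 0 (-(faceInclT T l A₀ A₁)) (-(faceInclT T l A₁ A₀)) (faceInclT T l A₁ A₁) := by
        rw [hQSR, Matrix.fromBlocks_multiply]
        ext (i | i) (j | j) <;> simp [P]
      have hSchur2 : (Matrix.fromBlocks 0 (-(faceInclT T l A₀ A₁)) (-(faceInclT T l A₁ A₀)) (faceInclT T l A₁ A₁)).det =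
          (faceInclT T l A₁ A₁).det * (-(faceInclT T l A₀ A₀)).det := by
        rw [Matrix.det_fromBlocks₂₂]
        simp only [Matrix.neg_mul, Matrix.mul_neg, neg_neg]
        rw [faceInclT_mul_invOf_mul hA₀₁, zero_sub]
      have hdet : (faceInclT T (c :: l) ℱ ℱ).det = (faceInclT T l A₂ A₂).det *
          ((Matrix.fromBlocks (1 : Matrix ↥A₀ ↥A₀ ℤ) 0 0 (-1 : Matrix ↥A₁ ↥A₁ ℤ)).det *
            ((faceInclT T l A₁ A₁).det * (-(faceInclT T l A₀ A₀)).det)) := by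
        rw [← Matrix.det_submatrix_equiv_self e, hM, Matrix.det_fromBlocks₂₂, hSchur1, Matrix.det_mul, hSchur2]
      rw [hdet, hdetD]
      exact ih2.mul (hn1.mul (ih1.mul hn0))
    · -- untwisted first coordinate: kernel `m` (as in THEOREM R***)
      let P : Matrix (↥A₀ ⊕ ↥A₁) (↥A₀ ⊕ ↥A₁) ℤ := Matrix.fromBlocks 0 (faceInclT T l A₀ A₁) 0 0
      let Q : Matrix (↥A₀ ⊕ ↥A₁) ↥A₂ ℤ :=
        Matrix.of fun i j => Sum.elim (fun _ => (0 : ℤ)) (fun i₁ => faceInclT T l A₁ A₂ i₁ j) i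
      let R : Matrix ↥A₂ (↥A₀ ⊕ ↥A₁) ℤ :=
        Matrix.of fun i j => Sum.elim (fun j₀ => faceInclT T l A₂ A₀ i j₀) (fun j₁ => faceInclT T l A₂ A₁ i j₁) j
      have hM : (faceInclT T (c :: l) ℱ ℱ).submatrix e e = Matrix.fromBlocks P Q R (faceInclT T l A₂ A₂) := by
        ext x y
        rcases x with ((q | q) | q) <;> rcases y with ((q' | q') | q')
        all_goals
          simp only [submatrix_apply, Matrix.fromBlocks_apply₁₁, Matrix.fromBlocks_apply₁₂, Matrix.fromBlocks_apply₂₁,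
            Matrix.fromBlocks_apply₂₂, P, Q, R, Matrix.of_apply, Sum.elim_inl, Sum.elim_inr, Matrix.zero_apply,
            faceInclT_apply, e_ll, e_lr, e_r]
        · rw [entry _ _ q.1 q'.1 (liftq q.1) (liftq q'.1), if_neg]
          rw [mem_relPairs, if_neg hcT]; rintro ⟨-, h⟩; exact (c0 q').1 (h (c0 q).1 (c0 q).2)
        · rw [entry _ _ q.1 q'.1 (liftq q.1) (lift1 q'.1), if_pos]
          rw [mem_relPairs, if_neg hcT]
          exact ⟨fun h => absurd h (c0 q).1, fun _ _ => mem_insert_self _ _⟩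
        · rw [entry _ _ q.1 q'.1 (liftq q.1) (lift2 q'.1), if_neg]
          rw [mem_relPairs, if_neg hcT]; rintro ⟨-, h⟩; exact (c2 q').1 (h (c0 q).1 (c0 q).2)
        · rw [entry _ _ q.1 q'.1 (lift1 q.1) (liftq q'.1), if_neg]
          rw [mem_relPairs, if_neg hcT]; rintro ⟨h, -⟩; exact (c0 q').2 (h (mem_insert_self _ _))
        · rw [entry _ _ q.1 q'.1 (lift1 q.1) (lift1 q'.1), if_neg]
          rw [mem_relPairs, if_neg hcT]; rintro ⟨h, -⟩; exact (c1 q').2 (h (mem_insert_self _ _))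
        · rw [entry _ _ q.1 q'.1 (lift1 q.1) (lift2 q'.1), if_pos]
          rw [mem_relPairs, if_neg hcT]
          exact ⟨fun _ => mem_insert_self _ _, fun h => absurd (mem_insert_self _ _) h⟩
        · rw [entry _ _ q.1 q'.1 (lift2 q.1) (liftq q'.1), if_pos]
          rw [mem_relPairs, if_neg hcT]
          exact ⟨fun h => absurd h (c2 q).1, fun _ h => absurd (mem_insert_self _ _) h⟩
        · rw [entry _ _ q.1 q'.1 (lift2 q.1) (lift1 q'.1), if_pos]
          rw [mem_relPairs, if_neg hcT]
          exact ⟨fun h => absurd h (c2 q).1, fun _ h => absurd (mem_insert_self _ _) h⟩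
        · rw [entry _ _ q.1 q'.1 (lift2 q.1) (lift2 q'.1), if_pos]
          rw [mem_relPairs, if_neg hcT]
          exact ⟨fun h => absurd h (c2 q).1, fun _ h => absurd (mem_insert_self _ _) h⟩
      have hQSR : Q * ⅟(faceInclT T l A₂ A₂) * R =
          Matrix.fromBlocks 0 0 (faceInclT T l A₁ A₀) (faceInclT T l A₁ A₁) := by
        have h1 : ∀ (B : Finset (Finset α × Finset α)),
            faceInclT T l A₁ A₂ * ⅟(faceInclT T l A₂ A₂) * faceInclT T l A₂ B = faceInclT T l A₁ B :=
          fun B => faceInclT_mul_invOf_mul hA₁₂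
        ext x y
        rcases x with (q | q) <;> rcases y with (q' | q')
        · simp [Q, R, Matrix.mul_apply]
        · simp [Q, R, Matrix.mul_apply]
        · have := congrFun (congrFun (h1 A₀) q) q'
          simp only [Matrix.mul_apply, Q, R, Matrix.of_apply, Sum.elim_inr, Sum.elim_inl,
            Matrix.fromBlocks_apply₂₁] at this ⊢
          exact this
        · have := congrFun (congrFun (h1 A₁) q) q'
          simp only [Matrix.mul_apply, Q, R, Matrix.of_apply, Sum.elim_inr, Matrix.fromBlocks_apply₂₂] at this ⊢
          exact this
      have hSchur1 : P - Q * ⅟(faceInclT T l A₂ A₂) * R = Matrix.fromBlocks (1 : Matrix ↥A₀ ↥A₀ ℤ) 0 0 (-1 : Matrix ↥A₁ ↥A₁ ℤ) *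
          Matrix.fromBlocks 0 (faceInclT T l A₀ A₁) (faceInclT T l A₁ A₀) (faceInclT T l A₁ A₁) := by
        rw [hQSR, Matrix.fromBlocks_multiply]
        ext (i | i) (j | j) <;> simp [P]
      have hSchur2 : (Matrix.fromBlocks 0 (faceInclT T l A₀ A₁) (faceInclT T l A₁ A₀) (faceInclT T l A₁ A₁)).det =
          (faceInclT T l A₁ A₁).det * (-(faceInclT T l A₀ A₀)).det := by
        rw [Matrix.det_fromBlocks₂₂, faceInclT_mul_invOf_mul hA₀₁, zero_sub]
      have hdet : (faceInclT T (c :: l) ℱ ℱ).det = (faceInclT T l A₂ A₂).det *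
          ((Matrix.fromBlocks (1 : Matrix ↥A₀ ↥A₀ ℤ) 0 0 (-1 : Matrix ↥A₁ ↥A₁ ℤ)).det *
            ((faceInclT T l A₁ A₁).det * (-(faceInclT T l A₀ A₀)).det)) := by
        rw [← Matrix.det_submatrix_equiv_self e, hM, Matrix.det_fromBlocks₂₂, hSchur1, Matrix.det_mul, hSchur2]
      rw [hdet, hdetD]
      exact ih2.mul (hn1.mul (ih1.mul hn0))

end SahiFComb.Shift

end Summit.CriticalPhenomena.PercolationContinuityZ3.Theorems
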